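import Literature.Probability.Percolation.CutBlocksLegCountUp
import HarnessLib

/-!
# Counting the landing legs across the lower, right and left faces off the bad event

Topic `Probability/Percolation`.  Support file (definitions and proofs, no named fact) for the named
fact `SchrammSmirnov2011_thm_1_7` (the landing count of the proof of Prop. 4.1, Ann. Probab. 39
(2011), §4): the DOWNWARD, RIGHTWARD and LEFTWARD landing legs of the collar exploration of
`CutBlocks.zones` (collar site `y ∈ 𝒪` with tube neighbour `y + e₁`, `y - e₀`, `y + e₀` and a wet
face of the leg) number at most `Σ faceN` over the lower, right, left faces off the total bad event
(`card_legsDown_le`, `card_legsRight_le`, `card_legsLeft_le`), exactly as the upward ones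
(`CutBlocksLegCountUp.lean`): the tube neighbour sits in the boundary row/column of a face block, and
in the frame of the face the collar site is `(x, 0)` over the tube site `(x, -1)`.

## References

* O. Schramm, S. Smirnov, *On the scaling limits of planar percolation*, Ann. Probab. 39 (2011)
  1768–1814, arXiv:1101.5820, §4, proof of Prop. 4.1. [SchrammSmirnov2011]
-/

noncomputable section

open MeasureTheory Set Metric Finset
open Literature.Probability.LatticeModels
open scoped Classical

namespace Literature.Probability.Percolation

namespace CutBlocks

open Seeded Seeded.CollarDatum

variable {s : ℝ} {α : Set ℂ} {δ : ℝ} {hs : 0 < s} {hδ : 0 < δ} {hα : Bornology.IsBounded α} {𝒵 : Seeded.Zones}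

/-- The unit vector `e₀`. [folklore] -/
abbrev e0 : Site 2 := Pi.single 0 1

/-- The first collar row index below the blocks at level `z₂`, reflected: `firstRow s δ (-z₂-1) = 1 - ⌈s z₂/δ⌉`. [folklore] -/
theorem firstRow_reflect (s δ : ℝ) (z₂ : ℤ) : firstRow s δ (-z₂ - 1) = 1 - ⌈s * z₂ / δ⌉ := by
  rw [firstRow, show (s * (((-z₂ - 1 : ℤ) : ℝ) + 1) / δ) = -(s * z₂ / δ) by push_cast; ring, Int.floor_neg]
  ring

/-! ### Downward legs -/

/-- **Downward landing legs** (collar site `y`, tube site `y + e₁`). [cite: SchrammSmirnov2011, §4, proof of Prop. 4.1] -/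
def legsDown (𝒵 : Seeded.Zones) (ω : BondConfig (Site 2)) : Finset (Site 2) :=
  𝒵.K.filter fun y => y + e1 ∈ 𝒵.N ∧
    Seeded.OReach 𝒵.collar.seeds (Seeded.examined 𝒵.collar.seeds ω) ω y ∧
    ∃ f, IsFaceOf f s(y, y + e1) ∧ Seeded.DReach 𝒵.collar.seeds (Seeded.examined 𝒵.collar.seeds ω) ω f

/-- The face of a downward leg. [folklore] -/
theorem exists_downFace_of_leg (h𝒵 : Compat hs hδ hα 𝒵) (hδs : δ ≤ s) {y : Site 2} (hyK : y ∈ 𝒵.K) (hn : y + e1 ∈ 𝒵.N) :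
    ∃ z ∈ downFaces hs hα, y 1 = ⌈s * z.2 / δ⌉ - 1 ∧ s * z.1 ≤ δ * y 0 ∧ δ * y 0 ≤ s * (z.1 + 1) := by
  rw [h𝒵.N_eq, mem_zones_N] at hn
  obtain ⟨z, hz, hnb⟩ := hn
  obtain ⟨h1, h2, h3, h4⟩ := hnb
  simp only [meshPoint_re, meshPoint_im, Pi.add_apply] at h1 h2 h3 h4
  simp at h1 h2 h3 h4
  have hyN : y ∉ Nset s α δ := fun h => h𝒵.not_mem_N_of_mem_K hyK ((mem_zones_N hs hδ hα).2 h)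
  have hbot : δ * y 1 < s * z.2 := by
    by_contra h
    push Not at h
    exact hyN ⟨z, hz, by
      simp only [block, mem_setOf_eq, meshPoint_re, meshPoint_im]
      exact ⟨h1, h2, h, by linarith⟩⟩
  have hdown : (z.1, z.2 - 1) ∉ tubeBlocks s α := fun h =>
    hyN ⟨_, h, by
      simp only [block, mem_setOf_eq, meshPoint_re, meshPoint_im]
      push_cast
      exact ⟨h1, h2, by linarith, by linarith⟩⟩
  refine ⟨z, ?_, ?_, h1, h2⟩
  · rw [downFaces, Finset.mem_filter, mem_tubeFinset]; exact ⟨hz, hdown⟩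
  · have : ⌈s * z.2 / δ⌉ = y 1 + 1 := by
      rw [Int.ceil_eq_iff, div_le_iff₀ hδ, lt_div_iff₀ hδ]
      push_cast
      constructor <;> linarith
    omega

/-- The frame of the lower face on the leg. [folklore] -/
theorem frameDown_leg {y : Site 2} {z : ℤ × ℤ} (hy : y 1 = ⌈s * z.2 / δ⌉ - 1) :
    (frameDown s δ z).σ y = ![y 0, 0] ∧ (frameDown s δ z).σ (y + e1) = ![y 0, -1] := by
  have hr := firstRow_reflect s δ z.2
  constructor
  · change (downShift s δ (-z.2 - 1)).σ (LatticeSym.reflYSite y) = _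
    rw [downShift_apply, hr]; funext k; fin_cases k <;> simp [hy]
  · change (downShift s δ (-z.2 - 1)).σ (LatticeSym.reflYSite (y + e1)) = _
    rw [downShift_apply, hr]; funext k; fin_cases k <;> simp [hy]; ring

/-- **Off the bad event a downward leg is a landing column of its face.** [cite: SchrammSmirnov2011, §4, proof of Prop. 4.1] -/
theorem landingAt_of_leg_down (h8 : 8 * δ ≤ s) {w₀ m : ℕ} (hw₀ : 2 ≤ w₀) {ω : BondConfig (Site 2)}
    (h𝒵 : Compat hs hδ hα 𝒵) (hω : ω ∉ badAll hs hα δ 𝒵 w₀ m) {y : Site 2} (hy : y ∈ legsDown 𝒵 ω) {z : ℤ × ℤ} (hz : z ∈ downFaces hs hα)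
    (hy1 : y 1 = ⌈s * z.2 / δ⌉ - 1) (hc1 : s * z.1 ≤ δ * y 0) (hc2 : δ * y 0 ≤ s * (z.1 + 1)) :
    faceA s δ z.1 ≤ y 0 ∧ y 0 ≤ faceB s δ z.1 ∧
      (𝒵.collar.map (frameDown s δ z)).LandingAt ((frameDown s δ z).relabel ω) (y 0) := by
  rw [legsDown, Finset.mem_filter] at hy
  obtain ⟨hyK, hnN, hO, f, hf, hD⟩ := hy
  obtain ⟨hσy, hσn⟩ := frameDown_leg (s := s) (δ := δ) hy1
  obtain ⟨hA, hB⟩ := faceA_sub_one_le (s := s) hδ hc1 hc2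
  have hnot : ω ∉ 𝒵.collar.badFace (frameDown s δ z) (faceA s δ z.1) (faceB s δ z.1) w₀ m := by
    intro h
    apply hω
    unfold badAll
    exact Or.inl (Or.inl (Or.inr (Set.mem_biUnion (Finset.mem_coe.2 hz) h)))
  have hO' : Seeded.OReach (𝒵.collar.map (frameDown s δ z)).seeds
      (Seeded.examined (𝒵.collar.map (frameDown s δ z)).seeds ((frameDown s δ z).relabel ω))
      ((frameDown s δ z).relabel ω) ![y 0, 0] := by
    rw [map_seeds, ← hσy]
    exact ((frameDown s δ z).oReach_examined_map_iff _ ω y).2 hO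
  have hfarA : w₀ < |y 0 - faceA s δ z.1| := by
    by_contra h
    push Not at h
    exact hnot (Or.inl (Or.inl ⟨y 0, h, hO'⟩))
  have hfarB : w₀ < |y 0 - faceB s δ z.1| := by
    by_contra h
    push Not at h
    exact hnot (Or.inl (Or.inr ⟨y 0, h, hO'⟩))
  have hxA : faceA s δ z.1 + w₀ < y 0 := by
    rw [lt_abs] at hfarA; rcases hfarA with h | h <;> omega
  have hxB : y 0 + w₀ < faceB s δ z.1 := by
    rw [lt_abs] at hfarB; rcases hfarB with h | h <;> omega
  refine ⟨by omega, by omega, ?_⟩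
  have hW : (𝒵.collar.map (frameDown s δ z)).CleanWindow (y 0) 0 0 :=
    h𝒵.cleanWindow (cleanWindow_of_wallFaceBottom_fit hs hδ hα h8 (wallFaceBottom_of_mem_downFaces hz) (by omega) (by omega))
  exact landingAt_map_of_leg hW (by push_cast; omega) (by push_cast; omega) hσy hσn hO hf hD

/-- **The downward landing legs are few off the bad event.** [cite: SchrammSmirnov2011, §4, proof of Prop. 4.1] -/
theorem card_legsDown_le (h8 : 8 * δ ≤ s) {w₀ m : ℕ} (hw₀ : 2 ≤ w₀) (hm : 2 ≤ m) {ω : BondConfig (Site 2)}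
    (h𝒵 : Compat hs hδ hα 𝒵) (hω : ω ∉ badAll hs hα δ 𝒵 w₀ m) :
    (legsDown 𝒵 ω).card ≤ ∑ z ∈ downFaces hs hα, faceN (faceA s δ z.1) (faceB s δ z.1) w₀ m := by
  have hδs : δ ≤ s := by linarith
  have hface : ∀ y ∈ legsDown 𝒵 ω, ∃ z ∈ downFaces hs hα,
      y 1 = ⌈s * z.2 / δ⌉ - 1 ∧ s * z.1 ≤ δ * y 0 ∧ δ * y 0 ≤ s * (z.1 + 1) := by
    intro y hy
    have hy' := hy
    rw [legsDown, Finset.mem_filter] at hy'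
    exact exists_downFace_of_leg h𝒵 hδs hy'.1 hy'.2.1
  choose! zOf hzOf using hface
  set T : Finset (Σ _ : ℤ × ℤ, ℤ) := (downFaces hs hα).sigma fun z =>
    landCols 𝒵.collar (frameDown s δ z) (faceA s δ z.1) (faceB s δ z.1) ω with hT
  have hmaps : ∀ y ∈ legsDown 𝒵 ω, (⟨zOf y, y 0⟩ : Σ _ : ℤ × ℤ, ℤ) ∈ T := by
    intro y hy
    obtain ⟨hz, hy1, hc1, hc2⟩ := hzOf y hy
    obtain ⟨hA, hB, hland⟩ := landingAt_of_leg_down h8 hw₀ h𝒵 hω hy hz hy1 hc1 hc2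
    rw [hT, Finset.mem_sigma]
    exact ⟨hz, by rw [landCols, Finset.mem_filter, Finset.mem_Icc]; exact ⟨⟨hA, hB⟩, hland⟩⟩
  have hinj : Set.InjOn (fun y => (⟨zOf y, y 0⟩ : Σ _ : ℤ × ℤ, ℤ)) ↑(legsDown 𝒵 ω) := by
    intro y hy y' hy' h
    simp only [Sigma.mk.injEq, heq_eq_eq] at h
    obtain ⟨hzz, h0⟩ := h
    have h1 : y 1 = y' 1 := by rw [(hzOf y hy).2.1, (hzOf y' hy').2.1, hzz]
    funext k; fin_cases k
    · exact h0
    · exact h1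
  calc (legsDown 𝒵 ω).card ≤ T.card := Finset.card_le_card_of_injOn _ hmaps hinj
    _ = ∑ z ∈ downFaces hs hα, (landCols 𝒵.collar (frameDown s δ z) (faceA s δ z.1) (faceB s δ z.1) ω).card := by
        rw [hT, Finset.card_sigma]
    _ ≤ ∑ z ∈ downFaces hs hα, faceN (faceA s δ z.1) (faceB s δ z.1) w₀ m := by
        refine Finset.sum_le_sum fun z hz => card_landings_le_of_not_bad hm ?_ (coe_landCols_subset _ _ _ _ _)
        intro h
        apply hω
        unfold badAll
        exact Or.inl (Or.inl (Or.inr (Set.mem_biUnion (Finset.mem_coe.2 hz) h)))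

/-! ### Rightward legs -/

/-- **Rightward landing legs** (collar site `y`, tube site `y - e₀`). [cite: SchrammSmirnov2011, §4, proof of Prop. 4.1] -/
def legsRight (𝒵 : Seeded.Zones) (ω : BondConfig (Site 2)) : Finset (Site 2) :=
  𝒵.K.filter fun y => y - e0 ∈ 𝒵.N ∧
    Seeded.OReach 𝒵.collar.seeds (Seeded.examined 𝒵.collar.seeds ω) ω y ∧
    ∃ f, IsFaceOf f s(y, y - e0) ∧ Seeded.DReach 𝒵.collar.seeds (Seeded.examined 𝒵.collar.seeds ω) ω f

/-- The face of a rightward leg. [folklore] -/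
theorem exists_rightFace_of_leg (h𝒵 : Compat hs hδ hα 𝒵) (hδs : δ ≤ s) {y : Site 2} (hyK : y ∈ 𝒵.K) (hn : y - e0 ∈ 𝒵.N) :
    ∃ z ∈ rightFaces hs hα, y 0 = firstRow s δ z.1 ∧ s * z.2 ≤ δ * y 1 ∧ δ * y 1 ≤ s * (z.2 + 1) := by
  rw [h𝒵.N_eq, mem_zones_N] at hn
  obtain ⟨z, hz, hnb⟩ := hn
  obtain ⟨h1, h2, h3, h4⟩ := hnb
  simp only [meshPoint_re, meshPoint_im, Pi.sub_apply] at h1 h2 h3 h4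
  simp at h1 h2 h3 h4
  have hyN : y ∉ Nset s α δ := fun h => h𝒵.not_mem_N_of_mem_K hyK ((mem_zones_N hs hδ hα).2 h)
  have hright : s * (z.1 + 1) < δ * y 0 := by
    by_contra h
    push Not at h
    exact hyN ⟨z, hz, by
      simp only [block, mem_setOf_eq, meshPoint_re, meshPoint_im]
      exact ⟨by linarith, h, h3, h4⟩⟩
  have hnb' : (z.1 + 1, z.2) ∉ tubeBlocks s α := fun h =>
    hyN ⟨_, h, by
      simp only [block, mem_setOf_eq, meshPoint_re, meshPoint_im]
      push_cast
      exact ⟨hright.le, by linarith, h3, h4⟩⟩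
  refine ⟨z, ?_, ?_, h3, h4⟩
  · rw [rightFaces, Finset.mem_filter, mem_tubeFinset]; exact ⟨hz, hnb'⟩
  · rw [firstRow]
    have : ⌊s * (z.1 + 1) / δ⌋ = y 0 - 1 := by
      rw [Int.floor_eq_iff, div_lt_iff₀ hδ, le_div_iff₀ hδ]
      push_cast
      constructor <;> linarith
    omega

/-- The frame of the right face on the leg. [folklore] -/
theorem frameRight_leg {y : Site 2} {z : ℤ × ℤ} (hy : y 0 = firstRow s δ z.1) :
    (frameRight s δ z).σ y = ![y 1, 0] ∧ (frameRight s δ z).σ (y - e0) = ![y 1, -1] := by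
  constructor
  · change (downShift s δ z.1).σ (LatticeSym.swapSite y) = _
    rw [downShift_apply]; funext k; fin_cases k <;> simp [hy]
  · change (downShift s δ z.1).σ (LatticeSym.swapSite (y - e0)) = _
    rw [downShift_apply]; funext k; fin_cases k <;> simp [hy]; ring

/-- **Off the bad event a rightward leg is a landing column of its face.** [cite: SchrammSmirnov2011, §4, proof of Prop. 4.1] -/
theorem landingAt_of_leg_right (h8 : 8 * δ ≤ s) {w₀ m : ℕ} (hw₀ : 2 ≤ w₀) {ω : BondConfig (Site 2)}
    (h𝒵 : Compat hs hδ hα 𝒵) (hω : ω ∉ badAll hs hα δ 𝒵 w₀ m) {y : Site 2} (hy : y ∈ legsRight 𝒵 ω) {z : ℤ × ℤ} (hz : z ∈ rightFaces hs hα)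
    (hy0 : y 0 = firstRow s δ z.1) (hc1 : s * z.2 ≤ δ * y 1) (hc2 : δ * y 1 ≤ s * (z.2 + 1)) :
    faceA s δ z.2 ≤ y 1 ∧ y 1 ≤ faceB s δ z.2 ∧
      (𝒵.collar.map (frameRight s δ z)).LandingAt ((frameRight s δ z).relabel ω) (y 1) := by
  rw [legsRight, Finset.mem_filter] at hy
  obtain ⟨hyK, hnN, hO, f, hf, hD⟩ := hy
  obtain ⟨hσy, hσn⟩ := frameRight_leg (s := s) (δ := δ) hy0
  obtain ⟨hA, hB⟩ := faceA_sub_one_le (s := s) (z := (z.2, z.1)) hδ hc1 hc2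
  simp only at hA hB
  have hnot : ω ∉ 𝒵.collar.badFace (frameRight s δ z) (faceA s δ z.2) (faceB s δ z.2) w₀ m := by
    intro h
    apply hω
    unfold badAll
    exact Or.inl (Or.inr (Set.mem_biUnion (Finset.mem_coe.2 hz) h))
  have hO' : Seeded.OReach (𝒵.collar.map (frameRight s δ z)).seeds
      (Seeded.examined (𝒵.collar.map (frameRight s δ z)).seeds ((frameRight s δ z).relabel ω))
      ((frameRight s δ z).relabel ω) ![y 1, 0] := by
    rw [map_seeds, ← hσy]
    exact ((frameRight s δ z).oReach_examined_map_iff _ ω y).2 hO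
  have hfarA : w₀ < |y 1 - faceA s δ z.2| := by
    by_contra h
    push Not at h
    exact hnot (Or.inl (Or.inl ⟨y 1, h, hO'⟩))
  have hfarB : w₀ < |y 1 - faceB s δ z.2| := by
    by_contra h
    push Not at h
    exact hnot (Or.inl (Or.inr ⟨y 1, h, hO'⟩))
  have hxA : faceA s δ z.2 + w₀ < y 1 := by
    rw [lt_abs] at hfarA; rcases hfarA with h | h <;> omega
  have hxB : y 1 + w₀ < faceB s δ z.2 := by
    rw [lt_abs] at hfarB; rcases hfarB with h | h <;> omega
  refine ⟨by omega, by omega, ?_⟩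
  have hW : (𝒵.collar.map (frameRight s δ z)).CleanWindow (y 1) 0 0 :=
    h𝒵.cleanWindow (cleanWindow_of_wallFaceRight_fit hs hδ hα h8 (wallFaceRight_of_mem_rightFaces hz) (by omega) (by omega))
  exact landingAt_map_of_leg hW (by push_cast; omega) (by push_cast; omega) hσy hσn hO hf hD

/-- **The rightward landing legs are few off the bad event.** [cite: SchrammSmirnov2011, §4, proof of Prop. 4.1] -/
theorem card_legsRight_le (h8 : 8 * δ ≤ s) {w₀ m : ℕ} (hw₀ : 2 ≤ w₀) (hm : 2 ≤ m) {ω : BondConfig (Site 2)}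
    (h𝒵 : Compat hs hδ hα 𝒵) (hω : ω ∉ badAll hs hα δ 𝒵 w₀ m) :
    (legsRight 𝒵 ω).card ≤ ∑ z ∈ rightFaces hs hα, faceN (faceA s δ z.2) (faceB s δ z.2) w₀ m := by
  have hδs : δ ≤ s := by linarith
  have hface : ∀ y ∈ legsRight 𝒵 ω, ∃ z ∈ rightFaces hs hα,
      y 0 = firstRow s δ z.1 ∧ s * z.2 ≤ δ * y 1 ∧ δ * y 1 ≤ s * (z.2 + 1) := by
    intro y hy
    have hy' := hy
    rw [legsRight, Finset.mem_filter] at hy'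
    exact exists_rightFace_of_leg h𝒵 hδs hy'.1 hy'.2.1
  choose! zOf hzOf using hface
  set T : Finset (Σ _ : ℤ × ℤ, ℤ) := (rightFaces hs hα).sigma fun z =>
    landCols 𝒵.collar (frameRight s δ z) (faceA s δ z.2) (faceB s δ z.2) ω with hT
  have hmaps : ∀ y ∈ legsRight 𝒵 ω, (⟨zOf y, y 1⟩ : Σ _ : ℤ × ℤ, ℤ) ∈ T := by
    intro y hy
    obtain ⟨hz, hy0, hc1, hc2⟩ := hzOf y hy
    obtain ⟨hA, hB, hland⟩ := landingAt_of_leg_right h8 hw₀ h𝒵 hω hy hz hy0 hc1 hc2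
    rw [hT, Finset.mem_sigma]
    exact ⟨hz, by rw [landCols, Finset.mem_filter, Finset.mem_Icc]; exact ⟨⟨hA, hB⟩, hland⟩⟩
  have hinj : Set.InjOn (fun y => (⟨zOf y, y 1⟩ : Σ _ : ℤ × ℤ, ℤ)) ↑(legsRight 𝒵 ω) := by
    intro y hy y' hy' h
    simp only [Sigma.mk.injEq, heq_eq_eq] at h
    obtain ⟨hzz, h1⟩ := h
    have h0 : y 0 = y' 0 := by rw [(hzOf y hy).2.1, (hzOf y' hy').2.1, hzz]
    funext k; fin_cases k
    · exact h0
    · exact h1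
  calc (legsRight 𝒵 ω).card ≤ T.card := Finset.card_le_card_of_injOn _ hmaps hinj
    _ = ∑ z ∈ rightFaces hs hα, (landCols 𝒵.collar (frameRight s δ z) (faceA s δ z.2) (faceB s δ z.2) ω).card := by
        rw [hT, Finset.card_sigma]
    _ ≤ ∑ z ∈ rightFaces hs hα, faceN (faceA s δ z.2) (faceB s δ z.2) w₀ m := by
        refine Finset.sum_le_sum fun z hz => card_landings_le_of_not_bad hm ?_ (coe_landCols_subset _ _ _ _ _)
        intro h
        apply hω
        unfold badAll
        exact Or.inl (Or.inr (Set.mem_biUnion (Finset.mem_coe.2 hz) h))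

/-! ### Leftward legs -/

/-- **Leftward landing legs** (collar site `y`, tube site `y + e₀`). [cite: SchrammSmirnov2011, §4, proof of Prop. 4.1] -/
def legsLeft (𝒵 : Seeded.Zones) (ω : BondConfig (Site 2)) : Finset (Site 2) :=
  𝒵.K.filter fun y => y + e0 ∈ 𝒵.N ∧
    Seeded.OReach 𝒵.collar.seeds (Seeded.examined 𝒵.collar.seeds ω) ω y ∧
    ∃ f, IsFaceOf f s(y, y + e0) ∧ Seeded.DReach 𝒵.collar.seeds (Seeded.examined 𝒵.collar.seeds ω) ω f

/-- The face of a leftward leg. [folklore] -/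
theorem exists_leftFace_of_leg (h𝒵 : Compat hs hδ hα 𝒵) (hδs : δ ≤ s) {y : Site 2} (hyK : y ∈ 𝒵.K) (hn : y + e0 ∈ 𝒵.N) :
    ∃ z ∈ leftFaces hs hα, y 0 = ⌈s * z.1 / δ⌉ - 1 ∧ s * z.2 ≤ δ * y 1 ∧ δ * y 1 ≤ s * (z.2 + 1) := by
  rw [h𝒵.N_eq, mem_zones_N] at hn
  obtain ⟨z, hz, hnb⟩ := hn
  obtain ⟨h1, h2, h3, h4⟩ := hnb
  simp only [meshPoint_re, meshPoint_im, Pi.add_apply] at h1 h2 h3 h4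
  simp at h1 h2 h3 h4
  have hyN : y ∉ Nset s α δ := fun h => h𝒵.not_mem_N_of_mem_K hyK ((mem_zones_N hs hδ hα).2 h)
  have hleft : δ * y 0 < s * z.1 := by
    by_contra h
    push Not at h
    exact hyN ⟨z, hz, by
      simp only [block, mem_setOf_eq, meshPoint_re, meshPoint_im]
      exact ⟨h, by linarith, h3, h4⟩⟩
  have hnb' : (z.1 - 1, z.2) ∉ tubeBlocks s α := fun h =>
    hyN ⟨_, h, by
      simp only [block, mem_setOf_eq, meshPoint_re, meshPoint_im]
      push_cast
      exact ⟨by linarith, by linarith, h3, h4⟩⟩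
  refine ⟨z, ?_, ?_, h3, h4⟩
  · rw [leftFaces, Finset.mem_filter, mem_tubeFinset]; exact ⟨hz, hnb'⟩
  · have : ⌈s * z.1 / δ⌉ = y 0 + 1 := by
      rw [Int.ceil_eq_iff, div_le_iff₀ hδ, lt_div_iff₀ hδ]
      push_cast
      constructor <;> linarith
    omega

/-- The frame of the left face on the leg. [folklore] -/
theorem frameLeft_leg {y : Site 2} {z : ℤ × ℤ} (hy : y 0 = ⌈s * z.1 / δ⌉ - 1) :
    (frameLeft s δ z).σ y = ![y 1, 0] ∧ (frameLeft s δ z).σ (y + e0) = ![y 1, -1] := by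
  have hr := firstRow_reflect s δ z.1
  constructor
  · change (downShift s δ (-z.1 - 1)).σ (LatticeSym.reflYSite (LatticeSym.swapSite y)) = _
    rw [downShift_apply, hr]; funext k; fin_cases k <;> simp [hy]
  · change (downShift s δ (-z.1 - 1)).σ (LatticeSym.reflYSite (LatticeSym.swapSite (y + e0))) = _
    rw [downShift_apply, hr]; funext k; fin_cases k <;> simp [hy]; ring

/-- **Off the bad event a leftward leg is a landing column of its face.** [cite: SchrammSmirnov2011, §4, proof of Prop. 4.1] -/
theorem landingAt_of_leg_left (h8 : 8 * δ ≤ s) {w₀ m : ℕ} (hw₀ : 2 ≤ w₀) {ω : BondConfig (Site 2)}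
    (h𝒵 : Compat hs hδ hα 𝒵) (hω : ω ∉ badAll hs hα δ 𝒵 w₀ m) {y : Site 2} (hy : y ∈ legsLeft 𝒵 ω) {z : ℤ × ℤ} (hz : z ∈ leftFaces hs hα)
    (hy0 : y 0 = ⌈s * z.1 / δ⌉ - 1) (hc1 : s * z.2 ≤ δ * y 1) (hc2 : δ * y 1 ≤ s * (z.2 + 1)) :
    faceA s δ z.2 ≤ y 1 ∧ y 1 ≤ faceB s δ z.2 ∧
      (𝒵.collar.map (frameLeft s δ z)).LandingAt ((frameLeft s δ z).relabel ω) (y 1) := by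
  rw [legsLeft, Finset.mem_filter] at hy
  obtain ⟨hyK, hnN, hO, f, hf, hD⟩ := hy
  obtain ⟨hσy, hσn⟩ := frameLeft_leg (s := s) (δ := δ) hy0
  obtain ⟨hA, hB⟩ := faceA_sub_one_le (s := s) (z := (z.2, z.1)) hδ hc1 hc2
  simp only at hA hB
  have hnot : ω ∉ 𝒵.collar.badFace (frameLeft s δ z) (faceA s δ z.2) (faceB s δ z.2) w₀ m := by
    intro h
    apply hω
    unfold badAll
    exact Or.inr (Set.mem_biUnion (Finset.mem_coe.2 hz) h)
  have hO' : Seeded.OReach (𝒵.collar.map (frameLeft s δ z)).seeds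
      (Seeded.examined (𝒵.collar.map (frameLeft s δ z)).seeds ((frameLeft s δ z).relabel ω))
      ((frameLeft s δ z).relabel ω) ![y 1, 0] := by
    rw [map_seeds, ← hσy]
    exact ((frameLeft s δ z).oReach_examined_map_iff _ ω y).2 hO
  have hfarA : w₀ < |y 1 - faceA s δ z.2| := by
    by_contra h
    push Not at h
    exact hnot (Or.inl (Or.inl ⟨y 1, h, hO'⟩))
  have hfarB : w₀ < |y 1 - faceB s δ z.2| := by
    by_contra h
    push Not at h
    exact hnot (Or.inl (Or.inr ⟨y 1, h, hO'⟩))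
  have hxA : faceA s δ z.2 + w₀ < y 1 := by
    rw [lt_abs] at hfarA; rcases hfarA with h | h <;> omega
  have hxB : y 1 + w₀ < faceB s δ z.2 := by
    rw [lt_abs] at hfarB; rcases hfarB with h | h <;> omega
  refine ⟨by omega, by omega, ?_⟩
  have hW : (𝒵.collar.map (frameLeft s δ z)).CleanWindow (y 1) 0 0 :=
    h𝒵.cleanWindow (cleanWindow_of_wallFaceLeft_fit hs hδ hα h8 (wallFaceLeft_of_mem_leftFaces hz) (by omega) (by omega))
  exact landingAt_map_of_leg hW (by push_cast; omega) (by push_cast; omega) hσy hσn hO hf hD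

/-- **The leftward landing legs are few off the bad event.** [cite: SchrammSmirnov2011, §4, proof of Prop. 4.1] -/
theorem card_legsLeft_le (h8 : 8 * δ ≤ s) {w₀ m : ℕ} (hw₀ : 2 ≤ w₀) (hm : 2 ≤ m) {ω : BondConfig (Site 2)}
    (h𝒵 : Compat hs hδ hα 𝒵) (hω : ω ∉ badAll hs hα δ 𝒵 w₀ m) :
    (legsLeft 𝒵 ω).card ≤ ∑ z ∈ leftFaces hs hα, faceN (faceA s δ z.2) (faceB s δ z.2) w₀ m := by
  have hδs : δ ≤ s := by linarith
  have hface : ∀ y ∈ legsLeft 𝒵 ω, ∃ z ∈ leftFaces hs hα,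
      y 0 = ⌈s * z.1 / δ⌉ - 1 ∧ s * z.2 ≤ δ * y 1 ∧ δ * y 1 ≤ s * (z.2 + 1) := by
    intro y hy
    have hy' := hy
    rw [legsLeft, Finset.mem_filter] at hy'
    exact exists_leftFace_of_leg h𝒵 hδs hy'.1 hy'.2.1
  choose! zOf hzOf using hface
  set T : Finset (Σ _ : ℤ × ℤ, ℤ) := (leftFaces hs hα).sigma fun z =>
    landCols 𝒵.collar (frameLeft s δ z) (faceA s δ z.2) (faceB s δ z.2) ω with hT
  have hmaps : ∀ y ∈ legsLeft 𝒵 ω, (⟨zOf y, y 1⟩ : Σ _ : ℤ × ℤ, ℤ) ∈ T := by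
    intro y hy
    obtain ⟨hz, hy0, hc1, hc2⟩ := hzOf y hy
    obtain ⟨hA, hB, hland⟩ := landingAt_of_leg_left h8 hw₀ h𝒵 hω hy hz hy0 hc1 hc2
    rw [hT, Finset.mem_sigma]
    exact ⟨hz, by rw [landCols, Finset.mem_filter, Finset.mem_Icc]; exact ⟨⟨hA, hB⟩, hland⟩⟩
  have hinj : Set.InjOn (fun y => (⟨zOf y, y 1⟩ : Σ _ : ℤ × ℤ, ℤ)) ↑(legsLeft 𝒵 ω) := by
    intro y hy y' hy' h
    simp only [Sigma.mk.injEq, heq_eq_eq] at h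
    obtain ⟨hzz, h1⟩ := h
    have h0 : y 0 = y' 0 := by rw [(hzOf y hy).2.1, (hzOf y' hy').2.1, hzz]
    funext k; fin_cases k
    · exact h0
    · exact h1
  calc (legsLeft 𝒵 ω).card ≤ T.card := Finset.card_le_card_of_injOn _ hmaps hinj
    _ = ∑ z ∈ leftFaces hs hα, (landCols 𝒵.collar (frameLeft s δ z) (faceA s δ z.2) (faceB s δ z.2) ω).card := by
        rw [hT, Finset.card_sigma]
    _ ≤ ∑ z ∈ leftFaces hs hα, faceN (faceA s δ z.2) (faceB s δ z.2) w₀ m := by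
        refine Finset.sum_le_sum fun z hz => card_landings_le_of_not_bad hm ?_ (coe_landCols_subset _ _ _ _ _)
        intro h
        apply hω
        unfold badAll
        exact Or.inr (Set.mem_biUnion (Finset.mem_coe.2 hz) h)

end CutBlocks

end Literature.Probability.Percolation

end
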